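import Mathlib
import HarnessLib

/-!
# Class-ordered (checkerboard-style) sweeps of deterministic local updates are sequential sweeps

HONEST FRAMING: exact (Metropolis-corrected) sampling algorithms for lattice gauge theory;
figures of merit are autocorrelation/cost numbers at stated couplings and volumes; no
continuum-physics claim.

Venture `LatticeQCDFlow` (cell pub-lqcd), topic `Exactness`; FANOUT row 9 (`eng-latcore`, the
`latflow.core` engine).  NEW WORK of the cell (elementary bookkeeping about functions on a
product of sites), not a published result; nothing is cited as a fact.

## Content

`latflow.core` 0.2.3 computes the CP(N−1) cooled topological charge of record (card S0-D2,
cooling schedule 'A') in C by running the single-site cooling projection SEQUENTIALLY through the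
schedule's class-ordered site list (`cpn_2d._cool_site_list`, kernel mode 5 of `cpn_sweep_sites`),
whereas the reference implementation (numpy) updates each colour class SIMULTANEOUSLY — every
site of the class from the OLD configuration.  The release notes justify "same operator" in one
clause: "same-class sites do not interact under the unimproved action".  The same question arose
for 4D cooling / over-relaxation in 0.2.2 (row 21's two-code check: serial site-major,
direction-major checkerboard and 16-colour block traversals are three DIFFERENT operators because
there the classes are NOT independent in the order they are run).  This file is the clause,
abstractly, for deterministic updates:

* `siteUpdate i u` — the map of configurations `x : ι → S` that rewrites site `i` to `u x` and
  leaves every other site alone; `ReadsOnly u R` — the rule `u` depends on the configuration only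
  through the sites in its stencil `R`;
* `siteUpdate_comm` — two site updates COMMUTE when the sites differ and neither lies in the
  other's stencil (the frame condition; a rule MAY read its own site — over-relaxation reflects the
  old value);
* `classUpdate c u` — the simultaneous update of the sites listed in `c` (the vectorised class
  update); `sweepInOrder c u` — the sequential loop through `c` in list order (the C traversal);
* `ClassIndep R c` — `c` has no duplicates and no listed site lies in ANOTHER listed site's stencil;
* `sweepInOrder_eq_classUpdate` — for an independent class the sequential loop IS the simultaneous
  update; hence (`sweepInOrder_perm`) every ordering of the class gives the same sweep;
* `scheduleSweep_eq_sweepInOrder_flatten` — a schedule (a list of classes, each independent) run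
  class after class with simultaneous updates equals ONE sequential loop through the concatenated,
  class-ordered site list — which is literally what `_cool_site_list` feeds the C kernel.

For CP(N−1) with the unimproved nearest-neighbour action the stencil of a site update (the site's
spin and its two forward links are rewritten together; they read the four neighbouring spins and
the attached links) contains no other site of the same colour as soon as same-coloured sites are
never nearest neighbours: schedule 'A' (`m ≥ 3` colours per axis with `m ∣ L`) on every extent,
the 2-colour checkerboard 'B' on EVEN extents only — on an odd extent two equal-parity sites are
neighbours across the periodic boundary, which is exactly the case the engine refuses
(`cooled_charge(impl='c')` raises for schedule 'B' on odd `L`; `impl='auto'` falls back to the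
vectorised path, whose class update is then NOT a sequential sweep).  Random updates (heat bath)
are not maps of configurations and are not covered here; their class-parallel execution is the
block / partition heat bath of `HeatBath.lean` and `PartitionHeatBath.lean`.
-/

namespace Summit.Ventures.LatticeQCDFlow.Exactness

variable {ι S : Type*} [DecidableEq ι]

section ClassSweep

/-- A deterministic single-site update as a map of configurations: site `i` of `x : ι → S` is
rewritten to the value `u x` computed from the current configuration; every other site is kept. -/
def siteUpdate (i : ι) (u : (ι → S) → S) (x : ι → S) : ι → S :=
  Function.update x i (u x)

/-- `ReadsOnly u R`: the update rule `u` depends on the configuration only through the sites in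
`R` — two configurations that agree on `R` receive the same new value.  (`R` is the rule's
stencil; it may contain the updated site itself.)  The standard "depends only on the coordinates
in `R`" notion, no single source. [folklore] -/
@[folklore]
def ReadsOnly (u : (ι → S) → S) (R : Set ι) : Prop :=
  ∀ x y : ι → S, (∀ k ∈ R, x k = y k) → u x = u y

/-- Unfolding lemma for `siteUpdate`. -/
theorem siteUpdate_apply (i : ι) (u : (ι → S) → S) (x : ι → S) :
    siteUpdate i u x = Function.update x i (u x) := rfl

/-- A rule that reads only `R` does not notice a rewrite at a site outside `R`. -/
theorem ReadsOnly.apply_update {u : (ι → S) → S} {R : Set ι} (h : ReadsOnly u R) {j : ι}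
    (hj : j ∉ R) (x : ι → S) (v : S) : u (Function.update x j v) = u x :=
  h _ _ fun _ hk => Function.update_of_ne (ne_of_mem_of_not_mem hk hj) v x

/-- FRAME CONDITION ⇒ COMMUTATION.  Two deterministic site updates at different sites commute as
maps of configurations when neither site lies in the other rule's stencil: each rule computes the
same value before and after the other's rewrite, and rewrites at different sites commute. -/
theorem siteUpdate_comm {i j : ι} {ui uj : (ι → S) → S} {Ri Rj : Set ι}
    (hi : ReadsOnly ui Ri) (hj : ReadsOnly uj Rj) (hij : i ≠ j) (hjR : j ∉ Ri) (hiR : i ∉ Rj) :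
    siteUpdate i ui ∘ siteUpdate j uj = siteUpdate j uj ∘ siteUpdate i ui := by
  funext x
  simp only [Function.comp_apply, siteUpdate_apply, hi.apply_update hjR, hj.apply_update hiR]
  exact Function.update_comm hij.symm _ _ _

/-- The SIMULTANEOUS ("vectorised") update of the sites listed in `c`: every listed site receives
its new value `u k x` computed from the OLD configuration `x`; unlisted sites are unchanged.  This
is what one numpy colour-class update does. -/
def classUpdate (c : List ι) (u : ι → (ι → S) → S) (x : ι → S) : ι → S :=
  fun k => if k ∈ c then u k x else x k

/-- Unfolding lemma for `classUpdate`. -/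
theorem classUpdate_apply (c : List ι) (u : ι → (ι → S) → S) (x : ι → S) (k : ι) :
    classUpdate c u x k = if k ∈ c then u k x else x k := rfl

/-- The simultaneous update depends on the list only through its set of members. -/
theorem classUpdate_perm {c c' : List ι} (h : c.Perm c') (u : ι → (ι → S) → S) :
    classUpdate c u = classUpdate c' u := by
  funext x k
  simp only [classUpdate_apply, h.mem_iff]

/-- The SEQUENTIAL sweep through the list `c` IN LIST ORDER (head first): the sites are updated one
at a time, each from the configuration left by the previous one.  This is the C kernel's loop over
a site list. -/
def sweepInOrder (c : List ι) (u : ι → (ι → S) → S) (x : ι → S) : ι → S :=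
  c.foldl (fun y i => siteUpdate i (u i) y) x

/-- The empty sweep is the identity. -/
theorem sweepInOrder_nil (u : ι → (ι → S) → S) (x : ι → S) : sweepInOrder [] u x = x := rfl

/-- A sweep through `a :: c` updates `a` first and then sweeps through `c`. -/
theorem sweepInOrder_cons (a : ι) (c : List ι) (u : ι → (ι → S) → S) (x : ι → S) :
    sweepInOrder (a :: c) u x = sweepInOrder c u (siteUpdate a (u a) x) := rfl

/-- A sweep through a concatenation is the two sweeps in turn. -/
theorem sweepInOrder_append (c d : List ι) (u : ι → (ι → S) → S) (x : ι → S) :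
    sweepInOrder (c ++ d) u x = sweepInOrder d u (sweepInOrder c u x) := by
  simp only [sweepInOrder, List.foldl_append]

/-- `ClassIndep R c`: the site list `c` is an INDEPENDENT CLASS for the stencils `R` — it has no
duplicate entries and no listed site lies in the stencil of ANOTHER listed site (a site may lie in
its own stencil) — i.e. `c` is an independent set of the stencils' dependency graph, the standard
colouring condition for parallel local updates; no single source. [folklore] -/
@[folklore]
def ClassIndep (R : ι → Set ι) (c : List ι) : Prop :=
  c.Nodup ∧ ∀ i ∈ c, ∀ j ∈ c, i ≠ j → j ∉ R i

omit [DecidableEq ι] in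
/-- The tail of an independent class is an independent class, and its head is not in the tail. -/
theorem ClassIndep.tail {R : ι → Set ι} {a : ι} {l : List ι} (h : ClassIndep R (a :: l)) :
    a ∉ l ∧ ClassIndep R l :=
  ⟨(List.nodup_cons.mp h.1).1, (List.nodup_cons.mp h.1).2,
    fun i hi j hj hij => h.2 i (List.mem_cons_of_mem a hi) j (List.mem_cons_of_mem a hj) hij⟩

omit [DecidableEq ι] in
/-- Independence is a property of the set of members: it transports along permutations. -/
theorem ClassIndep.perm {R : ι → Set ι} {c c' : List ι} (h : ClassIndep R c) (hp : c.Perm c') :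
    ClassIndep R c' :=
  ⟨hp.nodup_iff.mp h.1, fun i hi j hj => h.2 i (hp.mem_iff.mpr hi) j (hp.mem_iff.mpr hj)⟩

/-- SEQUENTIAL = SIMULTANEOUS on an independent class.  If every rule `u i` reads only its stencil
`R i` and the list `c` is an independent class for `R`, then sweeping through `c` one site at a
time (in list order) produces exactly the simultaneous update of the class. -/
theorem sweepInOrder_eq_classUpdate {R : ι → Set ι} {u : ι → (ι → S) → S}
    (hu : ∀ i, ReadsOnly (u i) (R i)) {c : List ι} (hc : ClassIndep R c) (x : ι → S) :
    sweepInOrder c u x = classUpdate c u x := by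
  induction c generalizing x with
  | nil =>
    funext k
    simp [sweepInOrder_nil, classUpdate_apply]
  | cons a l ih =>
    obtain ⟨hal, hl⟩ := hc.tail
    rw [sweepInOrder_cons, ih hl]
    funext k
    simp only [classUpdate_apply, siteUpdate_apply, List.mem_cons]
    by_cases hk : k ∈ l
    · have hka : k ≠ a := fun h => hal (h ▸ hk)
      have haR : a ∉ R k :=
        hc.2 k (List.mem_cons_of_mem a hk) a (List.mem_cons_self ..) hka
      simp only [hk, or_true, if_true, (hu k).apply_update haR]
    · by_cases hka : k = a
      · subst hka
        simp [hk]
      · simp [hk, hka]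

/-- Hence the ORDER of an independent class is immaterial: any two orderings of the class give the
same sequential sweep (both are the simultaneous update). -/
theorem sweepInOrder_perm {R : ι → Set ι} {u : ι → (ι → S) → S}
    (hu : ∀ i, ReadsOnly (u i) (R i)) {c c' : List ι} (hc : ClassIndep R c) (hp : c.Perm c')
    (x : ι → S) : sweepInOrder c u x = sweepInOrder c' u x := by
  rw [sweepInOrder_eq_classUpdate hu hc, sweepInOrder_eq_classUpdate hu (hc.perm hp),
    classUpdate_perm hp]

/-- A SCHEDULE of classes run one after the other IN LIST ORDER (head class first), each class as a
simultaneous update — the vectorised reference implementation of one sweep. -/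
def scheduleSweep (C : List (List ι)) (u : ι → (ι → S) → S) (x : ι → S) : ι → S :=
  C.foldl (fun y c => classUpdate c u y) x

/-- The empty schedule is the identity. -/
theorem scheduleSweep_nil (u : ι → (ι → S) → S) (x : ι → S) : scheduleSweep [] u x = x := rfl

/-- A schedule `c :: C` runs the class `c` first and then the schedule `C`. -/
theorem scheduleSweep_cons (c : List ι) (C : List (List ι)) (u : ι → (ι → S) → S) (x : ι → S) :
    scheduleSweep (c :: C) u x = scheduleSweep C u (classUpdate c u x) := rfl

/-- SCHEDULE OF SIMULTANEOUS CLASS UPDATES = ONE SEQUENTIAL SWEEP THROUGH THE CLASS-ORDERED SITE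
LIST.  If every class of the schedule is independent for the stencils, running the classes in turn
as simultaneous updates equals the single sequential loop through the concatenation of the classes
(any within-class order, by `sweepInOrder_perm`).  For `latflow.core`: the numpy schedule-'A'
cooling sweep of `cpn_2d` equals the C kernel's sequential pass over `_cool_site_list`. -/
theorem scheduleSweep_eq_sweepInOrder_flatten {R : ι → Set ι} {u : ι → (ι → S) → S}
    (hu : ∀ i, ReadsOnly (u i) (R i)) {C : List (List ι)} (hC : ∀ c ∈ C, ClassIndep R c)
    (x : ι → S) : scheduleSweep C u x = sweepInOrder C.flatten u x := by
  induction C generalizing x with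
  | nil => rfl
  | cons c C ih =>
    rw [scheduleSweep_cons, List.flatten_cons, sweepInOrder_append,
      sweepInOrder_eq_classUpdate hu (hC c (List.mem_cons_self ..))]
    exact ih (fun c' hc' => hC c' (List.mem_cons_of_mem c hc')) _

/-- The converse direction of use: WITHOUT independence the two disagree in general.  On two sites
reading each other (`u i x = x j`, a "copy your neighbour" rule on `Bool`-indexed `Bool` spins),
the simultaneous update of both sites SWAPS the two values while the sequential sweep makes them
EQUAL — the abstract form of row 21's finding that checkerboard and serial traversals of a
nearest-neighbour update are different operators when same-class sites interact. -/
theorem classUpdate_ne_sweepInOrder_example :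
    let u : Bool → (Bool → Bool) → Bool := fun i x => x (!i)
    let x : Bool → Bool := fun k => k
    classUpdate [false, true] u x ≠ sweepInOrder [false, true] u x := by
  intro u x h
  have h1 := congrFun h true
  simp [classUpdate_apply, sweepInOrder_cons, sweepInOrder_nil, siteUpdate_apply, u, x,
    Function.update] at h1

end ClassSweep

end Summit.Ventures.LatticeQCDFlow.Exactness
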